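import Literature.NumberTheory.GelbartRogawski1991.LocalDoubledUnitaryDatum
import Literature.NumberTheory.Automorphic.UnitaryGroupDoubledSiegelGeneration
import HarnessLib

-- buildfix G11b-3 recipe (LEDGER B13-1/B13-3): elaborate sequentially so the trailing `attribute [implicit_reducible]`
-- block (reducibilityCoreExt is keyed to the async environment branch) is in force at `.olean` export.
set_option Elab.async false

/-!
# The Siegel parabolic `P_Δ` of the doubled unitary group at a finite place: the Lagrangian condition
# `ι(h) ℓ_Δ = ℓ_Δ` IS the block condition `h₁₁ + h₁₂ = h₂₁ + h₂₂` ([Kudla1994, §3]; [HarrisKudlaSweet1996, §1 (1.11)])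

Topic `NumberTheory/GelbartRogawski1991`; namespace
`Literature.NumberTheory.GelbartRogawski1991.UnitaryDualPair.LocalSplitting` (sequel of `LocalDoubledUnitaryDatum`).
KERNEL only: proved lemmas; no named fact, no `sorry`.

`LocalDoubledUnitaryDatum` defines the Siegel condition of `h ∈ H(F_v) = U(J^𝔻)(F_v)` on the SYMPLECTIC side,
`IsSiegelDelta h :⇔ ι^𝔻_v(h) ℓ_Δ = ℓ_Δ` (`ℓ_Δ = Res_{E_v/F_v} Δ`, `Δ = {(u, u)} ⊂ 𝔻 = 𝕍 ⊕ (−𝕍)`), while the rest of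
the construction (the adelic Siegel parabolic of GR-2, `det_Δ`, the normal-closure theorem
`UnitaryGroupDoubledSiegelGeneration`) uses the MATRIX side: `DoubledUnitary.IsSiegelReindex e h_w`, i.e. the blocks
`b` of `reindex e⁻¹ e⁻¹ h_w` satisfy `b₁₁ + b₁₂ = b₂₁ + b₂₂` at every place `w ∣ v`.  This file proves they agree:

* §1 `ℓ_Δ` is the image under the quadratic coordinates `reIm` of the "diagonal" vectors of `(E ⊗ F_v)^{n+n}`
  (`localReIm_mem_deltaLagrangian_iff`);
* §2 `IsSiegelDelta h ↔ ι(h) ℓ_Δ ≤ ℓ_Δ` (finite dimension) `↔` the matrix of `h` over `E ⊗ F_v = Π_{w ∣ v} E_w` maps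
  diagonal vectors to diagonal vectors `↔` its `e₂`-blocks satisfy `g₁₁ + g₁₂ = g₂₁ + g₂₂` `↔` (componentwise)
  **`isSiegelDelta_iff : IsSiegelDelta h ↔ ∀ w ∣ v, DoubledUnitary.IsSiegelReindex (e₂ n) (h_w)`**.

Consequences recorded for the consumers: `P_Δ(F_v)` is a subgroup (`isSiegelDelta_one`, `IsSiegelDelta.mul`,
`IsSiegelDelta.inv`) — immediate on the Lagrangian side.

Written for the kernel construction of [GelbartRogawski1991, Prop. 3.1.1] behind the cited input `hGRU` of the
Hodge-CM period-theorem package (stage-1 cell `pub-hodgecm`, seat GR-1, 2026-08-21; brick L4a of the local skeleton).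

## References

* S. S. Kudla, Israel J. Math. 87 (1994) 361–401, §3 [Kudla1994].
* M. Harris, S. S. Kudla, W. J. Sweet, J. Amer. Math. Soc. 9 (1996) 941–1004, §1 (1.11) [HarrisKudlaSweet1996].
-/

set_option autoImplicit false

noncomputable section

open NumberField IsDedekindDomain Matrix
open Literature.RepresentationTheory.HeisenbergGroup
open Literature.NumberTheory.Automorphic Literature.NumberTheory.Automorphic.UnitaryGroup
open Literature.NumberTheory.Automorphic.UnitaryGroup.QuadraticCoordinates

namespace Literature.NumberTheory.GelbartRogawski1991.UnitaryDualPair.LocalSplitting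

variable (F : Type) [Field F] [NumberField F] (E : Type) [Field E] [NumberField E] [Algebra F E]
  [Algebra.IsQuadraticExtension F E] (c : E ≃ₐ[F] E)
  {δ : E} (hcδ : c δ = -δ) (hδ : δ ≠ 0) {d : F} (hd : δ * δ = algebraMap F E d)
  (v : HeightOneSpectrum (𝓞 F)) (n : ℕ) {T₀ : Matrix (Fin n) (Fin n) F} (hT₀ : T₀.IsSymm) (hT₀d : IsUnit T₀.det)
  {JD : Matrix (Fin (n + n)) (Fin (n + n)) E} (hJD : JD = (gramD F n T₀).map (algebraMap F E))

local notation "K" => HeightOneSpectrum.adicCompletion F v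
local notation "S" => LocalRing E v

/-! ## §1 `ℓ_Δ = reIm (diagonal vectors)` -/

/-- the local quadratic coordinates `reIm : (E ⊗ F_v)^{n+n} ≃ F_v^{n+n} × F_v^{n+n}` at `v`. [folklore] -/
abbrev localReImD : (Fin (n + n) → S) ≃+ ((Fin (n + n) → K) × (Fin (n + n) → K)) :=
  QuadraticCoordinates.reIm (quadraticLocalEquiv E v c hcδ hδ).toLinearEquiv.toAddEquiv (Fin (n + n))

/-- a vector `u ∈ (E ⊗ F_v)^{n+n}` is DIAGONAL (`u ∈ Δ ⊗ F_v`) if its `𝕍`- and `−𝕍`-halves agree. [cite: HarrisKudlaSweet1996, §1 (1.11)] -/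
def IsDiag (u : Fin (n + n) → S) : Prop := ∀ i : Fin n, u (e₂ n (Sum.inl i)) = u (e₂ n (Sum.inr i))

/-- **`reIm u ∈ ℓ_Δ ↔ u` is diagonal**: `ℓ_Δ = Res_{E_v/F_v}(Δ ⊗ F_v)`. [cite: HarrisKudlaSweet1996, §1 (1.11)] -/
theorem localReIm_mem_deltaLagrangian_iff (u : Fin (n + n) → S) :
    localReImD F E c hcδ hδ v n u ∈ deltaLagrangian F v n ↔ IsDiag F E v n u := by
  set Ψ := (quadraticLocalEquiv E v c hcδ hδ).toLinearEquiv.toAddEquiv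
  constructor
  · intro h i
    obtain ⟨h1, h2⟩ := h i
    simp only [localReImD, reIm_apply_fst, reIm_apply_snd] at h1 h2
    rw [← apply_re_im Ψ (u (e₂ n (Sum.inl i))), ← apply_re_im Ψ (u (e₂ n (Sum.inr i))), h1, h2]
  · intro h i
    simp only [localReImD, reIm_apply_fst, reIm_apply_snd, h i, and_self]

/-! ## §2 `IsSiegelDelta` = the block condition at every `w ∣ v` -/

/-- the matrix of `h ∈ H(F_v)` over `E ⊗ F_v = Π_{w ∣ v} E_w` (regrouped along `GL(Π E_w) = Π GL(E_w)`). [folklore] -/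
abbrev matS (h : UnitaryGroup.localPi E c (n + n) JD v) : Matrix (Fin (n + n)) (Fin (n + n)) S :=
  ((localPiEquiv E c (n + n) JD v h).1 : GL (Fin (n + n)) S).1

/-- `ι(h) (reIm u) = reIm (h u)` at the doubled datum (the tree's `localToSymplectic_reIm` through `iota_def`).
[cite: MoeglinVignerasWaldspurger1987, Ch. 1 I.17] -/
theorem iotaD_localReIm (h : UnitaryGroup.localPi E c (n + n) JD v) (u : Fin (n + n) → S) :
    toLin F v (iotaD F E c hcδ hδ hd v n hT₀ hJD h) (localReImD F E c hcδ hδ v n u) =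
      localReImD F E c hcδ hδ v n (matS F E c v n h *ᵥ u) := by
  rw [iotaD, iota_def, localPiToSymplectic, MonoidHom.comp_apply]
  exact localToSymplectic_reIm E c (n + n) v hcδ hδ hd (gramD_isSymm F n hT₀) hJD (localPiEquiv E c (n + n) JD v h) u

/-- `IsSiegelDelta h ↔ ι(h) ℓ_Δ ≤ ℓ_Δ` (an injective endomorphism of a finite-dimensional space preserves
dimensions). [cite: HarrisKudlaSweet1996, §1 (1.11)] -/
theorem isSiegelDelta_iff_map_le (h : UnitaryGroup.localPi E c (n + n) JD v) :
    IsSiegelDelta F E c hcδ hδ hd v n hT₀ hJD h ↔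
      (deltaLagrangian F v n).map (toLin F v (iotaD F E c hcδ hδ hd v n hT₀ hJD h)) ≤ deltaLagrangian F v n := by
  refine ⟨fun hS => hS.le, fun hle => ?_⟩
  apply Submodule.eq_of_le_of_finrank_eq hle
  exact LinearEquiv.finrank_map_eq _ _

/-- the diagonal vector with both halves `a`. [folklore] -/
private def dblS (a : Fin n → S) : Fin (n + n) → S := fun k => Sum.elim a a ((e₂ n).symm k)

omit [NumberField F] [Algebra.IsQuadraticExtension F E] in
/-- `dblS a` is diagonal. [folklore] -/
private theorem isDiag_dblS (a : Fin n → S) : IsDiag F E v n (dblS F E v n a) := fun i => by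
  simp only [dblS, Equiv.symm_apply_apply, Sum.elim_inl, Sum.elim_inr]

omit [NumberField F] [Algebra.IsQuadraticExtension F E] in
/-- a diagonal vector is `dblS` of its `𝕍`-half. [folklore] -/
private theorem eq_dblS_of_isDiag {u : Fin (n + n) → S} (hu : IsDiag F E v n u) :
    u = dblS F E v n (fun i => u (e₂ n (Sum.inl i))) := by
  funext k
  obtain ⟨s, rfl⟩ := (e₂ n).surjective k
  rcases s with i | i
  · simp only [dblS, Equiv.symm_apply_apply, Sum.elim_inl]
  · simp only [dblS, Equiv.symm_apply_apply, Sum.elim_inr, hu i]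

omit [NumberField F] [Algebra.IsQuadraticExtension F E] in
/-- the two halves of `g (dblS a)` are `(g₁₁ + g₁₂) a` and `(g₂₁ + g₂₂) a` for the `e₂`-blocks of `g`. [folklore] -/
private theorem mulVec_dblS (g : Matrix (Fin (n + n)) (Fin (n + n)) S) (a : Fin n → S) (i : Fin n) :
    (g *ᵥ dblS F E v n a) (e₂ n (Sum.inl i)) =
        (((Matrix.reindex (e₂ n).symm (e₂ n).symm g).toBlocks₁₁ +
          (Matrix.reindex (e₂ n).symm (e₂ n).symm g).toBlocks₁₂) *ᵥ a) i ∧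
      (g *ᵥ dblS F E v n a) (e₂ n (Sum.inr i)) =
        (((Matrix.reindex (e₂ n).symm (e₂ n).symm g).toBlocks₂₁ +
          (Matrix.reindex (e₂ n).symm (e₂ n).symm g).toBlocks₂₂) *ᵥ a) i := by
  constructor <;>
  · simp only [Matrix.mulVec, dotProduct, Matrix.add_apply, Matrix.toBlocks₁₁, Matrix.toBlocks₁₂,
      Matrix.toBlocks₂₁, Matrix.toBlocks₂₂, Matrix.reindex_apply, Matrix.submatrix_apply, Equiv.symm_symm,
      Matrix.of_apply, add_mul, Finset.sum_add_distrib]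
    rw [← (e₂ n).sum_comp, Fintype.sum_sum_type]
    simp only [dblS, Equiv.symm_apply_apply, Sum.elim_inl, Sum.elim_inr]

omit [NumberField F] [Algebra.IsQuadraticExtension F E] in
/-- a matrix `g` over `E ⊗ F_v` maps diagonal vectors to diagonal vectors iff its `e₂`-blocks satisfy
`g₁₁ + g₁₂ = g₂₁ + g₂₂`. [cite: HarrisKudlaSweet1996, §1 (1.11)] -/
theorem forall_isDiag_mulVec_iff (g : Matrix (Fin (n + n)) (Fin (n + n)) S) :
    (∀ u, IsDiag F E v n u → IsDiag F E v n (g *ᵥ u)) ↔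
      (Matrix.reindex (e₂ n).symm (e₂ n).symm g).toBlocks₁₁ + (Matrix.reindex (e₂ n).symm (e₂ n).symm g).toBlocks₁₂ =
        (Matrix.reindex (e₂ n).symm (e₂ n).symm g).toBlocks₂₁ + (Matrix.reindex (e₂ n).symm (e₂ n).symm g).toBlocks₂₂ := by
  constructor
  · intro h
    refine Matrix.toLin'.injective (LinearMap.ext fun a => ?_)
    rw [Matrix.toLin'_apply, Matrix.toLin'_apply]
    funext i
    have hi := h _ (isDiag_dblS F E v n a) i
    rw [(mulVec_dblS F E v n g a i).1, (mulVec_dblS F E v n g a i).2] at hi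
    exact hi
  · intro h u hu i
    rw [eq_dblS_of_isDiag F E v n hu, (mulVec_dblS F E v n g _ i).1, (mulVec_dblS F E v n g _ i).2, h]

omit [NumberField F] [Algebra.IsQuadraticExtension F E] in
/-- the block condition over `E ⊗ F_v = Π_{w ∣ v} E_w` is the block condition at every `w`. [cite: HarrisKudlaSweet1996, §1 (1.11)] -/
theorem blocks_eq_iff_forall_place (g : Matrix (Fin (n + n)) (Fin (n + n)) S) :
    (Matrix.reindex (e₂ n).symm (e₂ n).symm g).toBlocks₁₁ + (Matrix.reindex (e₂ n).symm (e₂ n).symm g).toBlocks₁₂ =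
        (Matrix.reindex (e₂ n).symm (e₂ n).symm g).toBlocks₂₁ + (Matrix.reindex (e₂ n).symm (e₂ n).symm g).toBlocks₂₂ ↔
      ∀ w : PlacesOver E v,
        (Matrix.reindex (e₂ n).symm (e₂ n).symm (g.map (Pi.evalRingHom _ w))).toBlocks₁₁ +
            (Matrix.reindex (e₂ n).symm (e₂ n).symm (g.map (Pi.evalRingHom _ w))).toBlocks₁₂ =
          (Matrix.reindex (e₂ n).symm (e₂ n).symm (g.map (Pi.evalRingHom _ w))).toBlocks₂₁ +
            (Matrix.reindex (e₂ n).symm (e₂ n).symm (g.map (Pi.evalRingHom _ w))).toBlocks₂₂ := by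
  rw [Matrix.eq_iff_forall_map_evalRingHom]
  refine forall_congr' fun w => ?_
  rw [Matrix.map_add _ (map_add _), Matrix.map_add _ (map_add _)]
  rfl

/-- **`P_Δ` on the symplectic side = `P_Δ` on the matrix side**: `ι^𝔻_v(h)` stabilises `ℓ_Δ = Res Δ` iff at every
place `w ∣ v` the `e₂`-blocks of `h_w` satisfy `h₁₁ + h₁₂ = h₂₁ + h₂₂` (`DoubledUnitary.IsSiegelReindex (e₂ n) h_w`, the
shape used by the adelic Siegel parabolic and by `UnitaryGroupDoubledSiegelGeneration`).
[cite: Kudla1994, §3; HarrisKudlaSweet1996, §1 (1.11)] -/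
theorem isSiegelDelta_iff_blocks (h : UnitaryGroup.localPi E c (n + n) JD v) :
    IsSiegelDelta F E c hcδ hδ hd v n hT₀ hJD h ↔
      ∀ w : PlacesOver E v,
        (Matrix.reindex (e₂ n).symm (e₂ n).symm
              (((h : UnitaryGroup.LocalGLPi E (n + n) v) w : GL (Fin (n + n)) (w.1.adicCompletion E)) :
                Matrix (Fin (n + n)) (Fin (n + n)) (w.1.adicCompletion E))).toBlocks₁₁ +
            (Matrix.reindex (e₂ n).symm (e₂ n).symm
              (((h : UnitaryGroup.LocalGLPi E (n + n) v) w : GL (Fin (n + n)) (w.1.adicCompletion E)) :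
                Matrix (Fin (n + n)) (Fin (n + n)) (w.1.adicCompletion E))).toBlocks₁₂ =
          (Matrix.reindex (e₂ n).symm (e₂ n).symm
              (((h : UnitaryGroup.LocalGLPi E (n + n) v) w : GL (Fin (n + n)) (w.1.adicCompletion E)) :
                Matrix (Fin (n + n)) (Fin (n + n)) (w.1.adicCompletion E))).toBlocks₂₁ +
            (Matrix.reindex (e₂ n).symm (e₂ n).symm
              (((h : UnitaryGroup.LocalGLPi E (n + n) v) w : GL (Fin (n + n)) (w.1.adicCompletion E)) :
                Matrix (Fin (n + n)) (Fin (n + n)) (w.1.adicCompletion E))).toBlocks₂₂ := by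
  rw [isSiegelDelta_iff_map_le, Submodule.map_le_iff_le_comap]
  -- the Lagrangian condition is the statement that `matS h` preserves diagonal vectors
  have step : (deltaLagrangian F v n ≤ (deltaLagrangian F v n).comap (toLin F v (iotaD F E c hcδ hδ hd v n hT₀ hJD h))) ↔
      ∀ u, IsDiag F E v n u → IsDiag F E v n (matS F E c v n h *ᵥ u) := by
    constructor
    · intro hle u hu
      have hmem : localReImD F E c hcδ hδ v n u ∈ deltaLagrangian F v n :=
        (localReIm_mem_deltaLagrangian_iff F E c hcδ hδ v n u).2 hu
      have := hle hmem
      rw [Submodule.mem_comap, iotaD_localReIm F E c hcδ hδ hd v n hT₀ hJD,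
        localReIm_mem_deltaLagrangian_iff] at this
      exact this
    · intro hall p hp
      obtain ⟨u, rfl⟩ : ∃ u, p = localReImD F E c hcδ hδ v n u :=
        ⟨(localReImD F E c hcδ hδ v n).symm p, (AddEquiv.apply_symm_apply _ p).symm⟩
      rw [Submodule.mem_comap, iotaD_localReIm F E c hcδ hδ hd v n hT₀ hJD, localReIm_mem_deltaLagrangian_iff]
      exact hall u ((localReIm_mem_deltaLagrangian_iff F E c hcδ hδ v n u).1 hp)
  rw [step, forall_isDiag_mulVec_iff, blocks_eq_iff_forall_place]
  refine forall_congr' fun w => ?_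
  -- the `w`-component of `matS h` is `h_w`
  have hw : (matS F E c v n h).map (Pi.evalRingHom _ w) =
      (((h : UnitaryGroup.LocalGLPi E (n + n) v) w : GL (Fin (n + n)) (w.1.adicCompletion E)) :
        Matrix (Fin (n + n)) (Fin (n + n)) (w.1.adicCompletion E)) := by
    rw [matS, coe_localPiEquiv_apply]
    exact GLn.map_piEquiv_symm _ _ _ w
  rw [hw]

/-- the same, in the vocabulary of `UnitaryGroupDoubledSiegelGeneration`: `IsSiegelDelta h ↔ ∀ w ∣ v,
DoubledUnitary.IsSiegelReindex (e₂ n) h_w` (the shape used by the adelic Siegel parabolic of the GR construction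
and by the normal-closure theorem). [cite: Kudla1994, §3; HarrisKudlaSweet1996, §1 (1.11)] -/
theorem isSiegelDelta_iff (h : UnitaryGroup.localPi E c (n + n) JD v) :
    IsSiegelDelta F E c hcδ hδ hd v n hT₀ hJD h ↔
      ∀ w : PlacesOver E v, DoubledUnitary.IsSiegelReindex (e₂ n)
        ((h : UnitaryGroup.LocalGLPi E (n + n) v) w : GL (Fin (n + n)) (w.1.adicCompletion E)) :=
  isSiegelDelta_iff_blocks F E c hcδ hδ hd v n hT₀ hJD h

/-! ## §3 `P_Δ(F_v)` is a subgroup -/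

/-- `1 ∈ P_Δ`. [cite: Kudla1994, §3] -/
theorem isSiegelDelta_one : IsSiegelDelta F E c hcδ hδ hd v n hT₀ hJD 1 := by
  unfold IsSiegelDelta
  rw [map_one]
  exact Submodule.map_id _

variable {F E c hcδ hδ hd v n hT₀ hJD} in
/-- `P_Δ` is closed under products. [cite: Kudla1994, §3] -/
theorem IsSiegelDelta.mul {h h' : UnitaryGroup.localPi E c (n + n) JD v}
    (hh : IsSiegelDelta F E c hcδ hδ hd v n hT₀ hJD h) (hh' : IsSiegelDelta F E c hcδ hδ hd v n hT₀ hJD h') :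
    IsSiegelDelta F E c hcδ hδ hd v n hT₀ hJD (h * h') := by
  unfold IsSiegelDelta at hh hh' ⊢
  rw [map_mul]
  have : toLin F v (iotaD F E c hcδ hδ hd v n hT₀ hJD h * iotaD F E c hcδ hδ hd v n hT₀ hJD h') =
      (toLin F v (iotaD F E c hcδ hδ hd v n hT₀ hJD h)).comp (toLin F v (iotaD F E c hcδ hδ hd v n hT₀ hJD h')) := rfl
  rw [this, Submodule.map_comp, hh', hh]

variable {F E c hcδ hδ hd v n hT₀ hJD} in
/-- `P_Δ` is closed under inverses. [cite: Kudla1994, §3] -/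
theorem IsSiegelDelta.inv {h : UnitaryGroup.localPi E c (n + n) JD v}
    (hh : IsSiegelDelta F E c hcδ hδ hd v n hT₀ hJD h) :
    IsSiegelDelta F E c hcδ hδ hd v n hT₀ hJD h⁻¹ := by
  unfold IsSiegelDelta at hh ⊢
  conv_lhs => rw [← hh]
  rw [← Submodule.map_comp]
  have : (toLin F v (iotaD F E c hcδ hδ hd v n hT₀ hJD h⁻¹)).comp (toLin F v (iotaD F E c hcδ hδ hd v n hT₀ hJD h)) =
      toLin F v (iotaD F E c hcδ hδ hd v n hT₀ hJD h⁻¹ * iotaD F E c hcδ hδ hd v n hT₀ hJD h) := rfl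
  rw [this, ← map_mul, inv_mul_cancel, map_one]
  exact Submodule.map_id _

/-! ### Build-lane note (ops-buildfix G11b-3 recipe, LEDGER B13-1, 2026-08-21)
`lean -o` (the hub build lane, never `lean`/the gate check) runs Lean 4.32's library-suggestion indexers
(`Lean.LibrarySuggestions.SymbolFrequency` / `SineQuaNon`, from their `exportEntriesFn`) over the statement of
every local theorem that is not a denied premise; on this family's statements (very large dependent binder
telescopes through the theta-kernel / dual-pair data) that fold runs for tens of minutes to hours and the build
lane kills the job (incident G11b-3, run/shared/lean/ops/buildfix/G11b-3-DOSSIER.md). `isDeniedPremise` skips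
`[implicit_reducible]` constants before any fold, and a reducibility status on a *theorem* is inert (Meta never
unfolds `thmInfo`; the kernel ignores the attribute), so the public theorems of this file are tagged
`[implicit_reducible]` purely to keep them out of that index. Only other effect: they are not offered by
`+suggestions` premise selectors. No statement or proof is changed; superseded if the operator lands a
deny-list form (`HarnessLib.PremiseIndex`). -/
set_option allowUnsafeReducibility true in
attribute [implicit_reducible]
  localReIm_mem_deltaLagrangian_iff iotaD_localReIm isSiegelDelta_iff_map_le
  forall_isDiag_mulVec_iff blocks_eq_iff_forall_place isSiegelDelta_iff_blocks isSiegelDelta_iff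
  isSiegelDelta_one IsSiegelDelta.mul IsSiegelDelta.inv

end Literature.NumberTheory.GelbartRogawski1991.UnitaryDualPair.LocalSplitting

end
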